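import Literature.Probability.RandomPlanarGeometry.SAWCountZdSymbolFiveRun
import HarnessLib

/-!
# SPLIT SHAPE CLASSES: a one-block class with one more, separated, adjacency loses exactly the reversal pairs there — `(2j−5)‼2^{2j−2} − (2j−7)‼2^{2j−3}`

Topic `Literature/Probability/RandomPlanarGeometry` (the «SYMBOL POLYNOMIALITY» programme, second layer; on `SAWCountZdSymbolFiveRun.lean` (a-p1 g26: `mem_shapeClass_iff`),
λ1–λ3 `SAWCountZdSymbolTop{Shapes,Data,Count}.lean` (a-p1 g25: `topVec`, `axCls_eq_pair_of_mem`, the bijection `pairsOf`/`signsOf` ↔ `canon ∘ mkWord` with `topData =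
pairPartitions (outside) ×ˢ powerset (freePos)`, `axisOf_eq_iff`, `canon_mkWord_mem_shapeClass`, both inverse laws, `card_shapeClass_top`, `card_outside`, `card_freePos`),
the perfect matchings of `HiggsFluctMeasureWickPairings.lean` (Glimm–Jaffe (3.2.13))).

PRINTED CONTEXT (locators only; nothing is quoted digit-for-digit). Madras–Slade (1993) §1.1 eq. (1.1.8) p. 5, Definition 1.2.4, §1.2 p. 10; Clisby–Liang–Slade (2007)
§3.3 eqs. (29)/(31); Glimm–Jaffe (1987) (3.2.13). NOT IN PRINT as far as the lane's desks could locate: the statements below.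

THE THEOREM. For `m = 2j`, a block position `i` (`i + 4 ≤ m`) and a SEPARATED extra adjacency `q` (`SepAdj m i q`: `q ≤ i − 2` or `q ≥ i + 4`, `q + 2 ≤ m`), the
split vector `splitVec m i q` (adjacencies `i, i+1, i+2, q`; run type `{4, 2}`) has ★★ `shapeClass_splitVec_eq_filter`: its class is the one-block class of
`topVec m i` MINUS the words with a reversal at `(q, q+1)` (the isolated pair carries no zero block). Through λ3's bijection a reversal pair at `(q, q+1)` is exactly
«`{q, q+1}` is a block of the matching and the signs at `q`, `q+1` differ» (★ `card_revPairs_eq_card_revData`), and these number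
`#pairPartitions(outside ∖ {q,q+1}) · 2^{#freePos − 1} = (2j−7)‼ · 2^{2j−3}` (`card_pairPartitions_filter_pair`, `card_powerset_filter_opposite`, ★★ `card_revData`).
Hence ★★★ **`card_shapeClass_splitVec : #shapeClass j (2j) (splitVec (2j) i q) + (2j−7)‼·2^{2j−3} = (2j−5)‼·2^{2j−2}`** (`j ≥ 3`; `j = 4`: `192 − 32 = 160` per vector,
`12·160 = 1920` of `U'_4 = 3456 = 1536 + 1920`).
Tool notions (the lane's): `SepAdj`, `splitVec`, `revData`.

THIS FILE (lane «pcv-sawmu», a-p1 g26; all PROVED, standard axioms): `SepAdj`, `splitVec`, `splitVec_eq_true_iff`, `adjValid_splitVec`, `breaks_splitVec`,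
★★ `shapeClass_splitVec_eq_filter`, `revData`, `sep_facts`, ★ `card_revPairs_eq_card_revData`, `card_pairPartitions_filter_pair` (private), `card_powerset_filter_opposite` (private),
★★ `card_revData`, ★★★ `card_shapeClass_splitVec`.
[cite: MadrasSlade1993, §1.1 eq. (1.1.8) p. 5; Definition 1.2.4; §1.2 (p. 10)] [cite: ClisbyLiangSlade2007, §3.3 eqs. (29)/(31)] [cite: GlimmJaffeQP1987, (3.2.13) §3.2]

Provenance: lane «pcv-sawmu», a-p1 g26 (2026-08-28).
-/

open Finset
open scoped BigOperators
open Literature.Probability.LatticeModels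
open Literature.Probability.RandomPlanarGeometry.SAW
open Literature.Probability.Percolation
open Literature.MathematicalPhysics.QuantumFieldTheory.Balaban1983to89
open Literature.MathematicalPhysics.QuantumFieldTheory.Balaban1983to89.HiggsFluctMeasureWickPairings

namespace Literature.Probability.RandomPlanarGeometry.SAW.Zd

namespace WordTypes

variable {m : ℕ}

/-- The extra adjacency `q` is SEPARATED from the block at `i`: `q ∉ {i−1, …, i+3}`, `q + 2 ≤ m`. [cite: MadrasSlade1993, Definition 1.2.4; lane tool notion] -/
abbrev SepAdj (m i q : ℕ) : Prop := (q + 2 ≤ i ∨ i + 4 ≤ q) ∧ q + 2 ≤ m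

/-- The SPLIT adjacency vector: adjacencies at `i, i+1, i+2` and at `q`. [cite: MadrasSlade1993, Definition 1.2.4; lane tool notion] -/
def splitVec (m i q : ℕ) : Fin m → Bool := fun k => decide ((i ≤ k.val ∧ k.val ≤ i + 2) ∨ k.val = q)

/-- `splitVec m i q k = true ↔ i ≤ k ≤ i + 2 ∨ k = q`. [cite: MadrasSlade1993, Definition 1.2.4; lane plumbing] -/
theorem splitVec_eq_true_iff {m i q : ℕ} (k : Fin m) : splitVec m i q k = true ↔ (i ≤ k.val ∧ k.val ≤ i + 2) ∨ k.val = q := by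
  simp [splitVec]

/-- `splitVec` is valid (`i + 4 ≤ m`, `SepAdj`). [cite: MadrasSlade1993, Definition 1.2.4; lane plumbing] -/
theorem adjValid_splitVec {m i q : ℕ} (hi : i + 4 ≤ m) (hq : SepAdj m i q) : AdjValid (splitVec m i q) := by
  intro h
  rw [Bool.eq_false_iff, Ne, splitVec_eq_true_iff]
  unfold SepAdj at hq
  simp only
  omega

open Classical in
/-- `splitVec` has four adjacencies, hence `m − 4` breaks. [cite: MadrasSlade1993, Definition 1.2.4; lane plumbing] -/
theorem breaks_splitVec {m i q : ℕ} (hi : i + 4 ≤ m) (hq : SepAdj m i q) : breaks (splitVec m i q) = m - 4 := by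
  unfold SepAdj at hq
  unfold breaks
  have htrue : (Finset.univ.filter fun k : Fin m => splitVec m i q k = true) =
      {⟨i, by omega⟩, ⟨i + 1, by omega⟩, ⟨i + 2, by omega⟩, ⟨q, by omega⟩} := by
    ext k
    rw [Finset.mem_filter, splitVec_eq_true_iff]
    simp only [Finset.mem_univ, true_and, Finset.mem_insert, Finset.mem_singleton, Fin.ext_iff]
    omega
  have h4 : (Finset.univ.filter fun k : Fin m => splitVec m i q k = true).card = 4 := by
    rw [htrue, Finset.card_insert_of_notMem (by simp [Fin.ext_iff]; omega), Finset.card_insert_of_notMem (by simp [Fin.ext_iff]; omega),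
      Finset.card_pair (by simp [Fin.ext_iff]; omega)]
  have hsum := Finset.card_filter_add_card_filter_not (s := (Finset.univ : Finset (Fin m))) (fun k : Fin m => splitVec m i q k = true)
  simp only [Finset.card_univ, Fintype.card_fin, Bool.not_eq_true] at hsum
  omega

/-! ### The split class is the one-block class minus the reversal pairs at `q` -/

open Classical in
/-- ★★ THE SPLIT CLASS: `shapeClass j m (splitVec m i q) = {κ ∈ shapeClass j m (topVec m i) | κ (q+1) ≠ rev κ q}` — the extra isolated adjacency
carries no zero block (length two would be a reversal) and adds exactly one no-reversal condition. [cite: MadrasSlade1993, Definition 1.2.4; lane theorem] -/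
theorem shapeClass_splitVec_eq_filter {j i q : ℕ} (hi : i + 4 ≤ m) (hq : SepAdj m i q) :
    shapeClass j m (splitVec m i q) =
      (shapeClass j m (topVec m i)).filter fun κ => ¬ κ ⟨q + 1, by unfold SepAdj at hq; omega⟩ = ((κ ⟨q, by unfold SepAdj at hq; omega⟩).1, !(κ ⟨q, by unfold SepAdj at hq; omega⟩).2) := by
  have hq' := hq
  unfold SepAdj at hq'
  ext κ
  rw [Finset.mem_filter, mem_shapeClass_iff, mem_shapeClass_iff]
  constructor
  · rintro ⟨hcan, hax, hrep, hnr, a, a', haa', ha', hA, hpos⟩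
    have h4 := four_le_of_zero_block _ κ hnr haa' ha' hA hpos
    -- the zero block uses three consecutive adjacencies: it is `[i, i+4)`
    have hlt0 : a < m := by omega
    have hlt1 : a + 1 < m := by omega
    have hlt2 : a + 2 < m := by omega
    have h1 := hA ⟨a, hlt0⟩ le_rfl (by simp only; omega)
    have h2 := hA ⟨a + 1, hlt1⟩ (by simp only; omega) (by simp only; omega)
    have h3 := hA ⟨a + 2, hlt2⟩ (by simp only; omega) (by simp only; omega)
    rw [splitVec_eq_true_iff] at h1 h2 h3
    simp only at h1 h2 h3
    have ha : a = i := by omega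
    have ha4 : a' = a + 4 := by
      by_contra hne
      have hlt3 : a + 3 < m := by omega
      have h35 := hA ⟨a + 3, hlt3⟩ (by simp only; omega) (by simp only; omega)
      rw [splitVec_eq_true_iff] at h35; simp only at h35; omega
    subst ha ha4
    refine ⟨⟨hcan, hax, hrep, fun k hk hAk => hnr k hk ?_, ⟨a, a + 4, haa', ha', fun k hk hk' => (topVec_eq_true_iff k).2 ⟨hk, by omega⟩, hpos⟩⟩, ?_⟩
    · rw [topVec_eq_true_iff] at hAk; rw [splitVec_eq_true_iff]; exact Or.inl hAk
    · exact hnr ⟨q, by omega⟩ (by simp only; omega) ((splitVec_eq_true_iff _).2 (Or.inr rfl))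
  · rintro ⟨⟨hcan, hax, hrep, hnr, a, a', haa', ha', hA, hpos⟩, hq1⟩
    refine ⟨hcan, hax, hrep, fun k hk hAk => ?_, ⟨a, a', haa', ha', fun k hk hk' => ?_, hpos⟩⟩
    · rw [splitVec_eq_true_iff] at hAk
      rcases hAk with hAk | hAk
      · exact hnr k hk ((topVec_eq_true_iff k).2 hAk)
      · have hql : q < m := by omega
        have hq1l : q + 1 < m := by omega
        have e1 : (⟨k.val + 1, hk⟩ : Fin m) = ⟨q + 1, hq1l⟩ := Fin.ext (by simp only; omega)
        rw [e1]
        have e0 : k = ⟨q, hql⟩ := Fin.ext hAk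
        rw [e0]
        exact hq1
    · have := hA k hk hk'
      rw [topVec_eq_true_iff] at this
      exact (splitVec_eq_true_iff k).2 (Or.inl this)

/-! ### Counting the reversal pairs at `q` inside a one-block class (`m = 2j`) -/

section RevPairs

variable {i q : ℕ}

open Classical in
/-- The reversal-pair data: perfect matchings of the outside containing the pair `{q, q+1}`, and sign sets with opposite signs at `q`, `q+1`.
[cite: MadrasSlade1993, Definition 1.2.4; lane tool notion] -/
noncomputable def revData (m i q : ℕ) (hq : q + 2 ≤ m) : Finset (Finset (Finset (Fin m)) × Finset (Fin m)) :=
  (topData m i).filter fun d => ({(⟨q, by omega⟩ : Fin m), ⟨q + 1, by omega⟩} : Finset (Fin m)) ∈ d.1 ∧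
    ((⟨q, by omega⟩ : Fin m) ∈ d.2 ↔ (⟨q + 1, by omega⟩ : Fin m) ∉ d.2)

/-- `q` and `q+1` are outside the block and free, for separated `q`. [cite: MadrasSlade1993, Definition 1.2.4; lane plumbing] -/
theorem sep_facts (hq : SepAdj m i q) :
    ¬ InB i (⟨q, by unfold SepAdj at hq; omega⟩ : Fin m) ∧ ¬ InB i (⟨q + 1, by unfold SepAdj at hq; omega⟩ : Fin m) ∧
      (⟨q, by unfold SepAdj at hq; omega⟩ : Fin m) ∈ freePos m i ∧ (⟨q + 1, by unfold SepAdj at hq; omega⟩ : Fin m) ∈ freePos m i := by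
  unfold SepAdj at hq
  unfold InB freePos
  simp only [Finset.mem_filter, Finset.mem_univ, true_and]
  omega

/-- ★ Through λ3's bijection, a reversal pair at `(q, q+1)` is exactly: `{q, q+1}` a block of the matching and opposite signs.
[cite: MadrasSlade1993, Definition 1.2.4; lane lemma] -/
theorem card_revPairs_eq_card_revData {j : ℕ} (hm : m = 2 * j) (hi : i + 4 ≤ m) (hq : SepAdj m i q) :
    ((shapeClass j m (topVec m i)).filter fun κ => κ ⟨q + 1, by unfold SepAdj at hq; omega⟩ =
        ((κ ⟨q, by unfold SepAdj at hq; omega⟩).1, !(κ ⟨q, by unfold SepAdj at hq; omega⟩).2)).card = (revData m i q hq.2).card := by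
  classical
  obtain ⟨hqB, hq1B, hqF, hq1F⟩ := sep_facts hq
  have hq' := hq; unfold SepAdj at hq'
  set Q : Fin m := ⟨q, by omega⟩ with hQ
  set Q1 : Fin m := ⟨q + 1, by omega⟩ with hQ1
  have hQQ : Q1 ≠ Q := by simp [hQ, hQ1, Fin.ext_iff]
  refine Finset.card_nbij' (fun κ => (pairsOf i κ, signsOf i κ)) (fun d => canon (mkWord hi d.1 d.2)) (fun κ hκ => ?_) (fun d hd => ?_)
    (fun κ hκ => ?_) (fun d hd => ?_)
  · -- forward: the pair is an axis class, the signs differ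
    rw [Finset.mem_coe, Finset.mem_filter] at hκ
    obtain ⟨hκ, hrev⟩ := hκ
    unfold revData
    rw [Finset.mem_coe, Finset.mem_filter]
    refine ⟨pairsOf_signsOf_mem_topData hm hκ hi, ?_, ?_⟩
    · -- `{q, q+1} = axCls κ q ∈ pairsOf`
      have hax : Q1 ∈ axCls κ Q := mem_axCls.2 (by rw [hrev])
      have hcls : axCls κ Q = {Q, Q1} := axCls_eq_pair_of_mem hm hκ hax hQQ
      change ({Q, Q1} : Finset (Fin m)) ∈ (outside m i).image (axCls κ)
      rw [← hcls]
      exact Finset.mem_image_of_mem _ (mem_outside.2 hqB)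
    · change Q ∈ signsOf i κ ↔ Q1 ∉ signsOf i κ
      unfold signsOf
      rw [Finset.mem_filter, Finset.mem_filter]
      have hs : (κ Q1).2 = !(κ Q).2 := by rw [hrev]
      simp only [hqF, hq1F, true_and, hs]
      cases (κ Q).2 <;> simp
  · -- backward: the built word has a reversal at `(q, q+1)`
    obtain ⟨π, S⟩ := d
    unfold revData at hd
    rw [Finset.mem_coe, Finset.mem_filter] at hd
    obtain ⟨hd, hpair, hsign⟩ := hd
    simp only at hpair hsign
    have hπ : π ∈ pairPartitions (outside m i) := by unfold topData at hd; exact (Finset.mem_product.1 hd).1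
    rw [Finset.mem_coe, Finset.mem_filter]
    refine ⟨canon_mkWord_mem_shapeClass hm hi hπ S, ?_⟩
    have hst : SameType (mkWord hi π S) (canon (mkWord hi π S)) := sameType_canon _
    -- axis: `q`, `q+1` share the block `{q, q+1}`
    have haxw : (mkWord hi π S Q).1 = (mkWord hi π S Q1).1 := by
      change axisOf hi π Q = axisOf hi π Q1
      rw [axisOf_eq_iff hi hπ]
      refine Or.inr ⟨hqB, hq1B, ?_⟩
      have hπ' := (mem_pairPartitions.1 hπ).1
      rw [hπ'.eq_blockOf hpair (by rw [Finset.mem_insert, Finset.mem_singleton]; exact Or.inl hQ),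
        hπ'.eq_blockOf hpair (by rw [Finset.mem_insert, Finset.mem_singleton]; exact Or.inr hQ1)]
    have hax : (canon (mkWord hi π S) Q1).1 = (canon (mkWord hi π S) Q).1 := ((hst.1 Q Q1).1 haxw).symm
    -- signs: free positions, opposite
    have hs0 : (canon (mkWord hi π S) Q).2 = decide (Q ∈ S) := by
      rw [hst.2 Q |>.symm]
      change signOf hi S Q = _
      unfold signOf; rw [if_neg (by simp [hQ]; omega), if_neg (by simp [hQ]; omega)]
    have hs1 : (canon (mkWord hi π S) Q1).2 = decide (Q1 ∈ S) := by
      rw [hst.2 Q1 |>.symm]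
      change signOf hi S Q1 = _
      unfold signOf; rw [if_neg (by simp [hQ1]; omega), if_neg (by simp [hQ1]; omega)]
    have hsign' : Q ∈ S ↔ Q1 ∉ S := by rw [hQ, hQ1]; exact hsign
    refine Prod.ext hax ?_
    simp only [hs0, hs1]
    by_cases h : Q ∈ S
    · have h1 : Q1 ∉ S := hsign'.1 h
      simp [h, h1]
    · have h1 : Q1 ∈ S := by by_contra h1; exact h (hsign'.2 h1)
      simp [h, h1]
  · exact canon_mkWord_pairsOf_signsOf hm (Finset.mem_filter.1 (Finset.mem_coe.1 hκ)).1 hi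
  · unfold revData at hd
    exact pairsOf_signsOf_canon_mkWord hi (Finset.mem_filter.1 (Finset.mem_coe.1 hd)).1

/-- Perfect matchings of `O` containing a given pair `{a, b} ⊆ O` ↔ perfect matchings of `O ∖ {a, b}`. [cite: GlimmJaffeQP1987, (3.2.13) §3.2; lane lemma] -/
private theorem card_pairPartitions_filter_pair {O : Finset (Fin m)} {a b : Fin m} (ha : a ∈ O) (hb : b ∈ O) (hab : a ≠ b) :
    ((pairPartitions O).filter fun π => ({a, b} : Finset (Fin m)) ∈ π).card = (pairPartitions (O \ {a, b})).card := by
  classical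
  refine Finset.card_nbij' (fun π => π.erase {a, b}) (fun σ => insert {a, b} σ) (fun π hπ => ?_) (fun σ hσ => ?_) (fun π hπ => ?_) (fun σ hσ => ?_)
  · rw [Finset.mem_coe, Finset.mem_filter, mem_pairPartitions] at hπ
    obtain ⟨⟨hπ, h2⟩, hab'⟩ := hπ
    rw [Finset.mem_coe, mem_pairPartitions]
    exact ⟨hπ.erase hab', fun B hB => h2 B (Finset.mem_of_mem_erase hB)⟩
  · rw [Finset.mem_coe, mem_pairPartitions] at hσ
    obtain ⟨hσ, h2⟩ := hσ
    rw [Finset.mem_coe, Finset.mem_filter, mem_pairPartitions]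
    refine ⟨⟨hσ.insert (by intro x hx; simp only [Finset.mem_insert, Finset.mem_singleton] at hx; rcases hx with rfl | rfl <;> assumption) ⟨a, by simp⟩,
      fun B hB => ?_⟩, Finset.mem_insert_self _ _⟩
    rcases Finset.mem_insert.1 hB with rfl | hB
    · exact Finset.card_pair hab
    · exact h2 B hB
  · rw [Finset.mem_coe, Finset.mem_filter] at hπ
    exact Finset.insert_erase hπ.2
  · rw [Finset.mem_coe, mem_pairPartitions] at hσ
    exact Finset.erase_insert (hσ.1.notMem_of_sdiff ⟨a, by simp⟩)

/-- Sign sets on `F` with opposite membership at `a ∈ F` and `b ≠ a`: `2^{#F − 1}` (erase `a`; it is recovered from `b`).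
[cite: MadrasSlade1993, Definition 1.2.4; lane lemma] -/
private theorem card_powerset_filter_opposite {F : Finset (Fin m)} {a b : Fin m} (ha : a ∈ F) (hab : a ≠ b) :
    (F.powerset.filter fun S => a ∈ S ↔ b ∉ S).card = 2 ^ (F.card - 1) := by
  classical
  rw [← Finset.card_erase_of_mem ha, ← Finset.card_powerset]
  refine Finset.card_nbij' (fun S => S.erase a) (fun T => if b ∈ T then T else insert a T) (fun S hS => ?_) (fun T hT => ?_) (fun S hS => ?_)
    (fun T hT => ?_)
  · rw [Finset.mem_coe, Finset.mem_filter, Finset.mem_powerset] at hS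
    rw [Finset.mem_coe, Finset.mem_powerset]
    exact Finset.erase_subset_erase _ hS.1
  · rw [Finset.mem_coe, Finset.mem_powerset, Finset.subset_erase] at hT
    rw [Finset.mem_coe, Finset.mem_filter, Finset.mem_powerset]
    dsimp only
    split_ifs with h
    · exact ⟨hT.1, iff_of_false hT.2 (not_not_intro h)⟩
    · refine ⟨Finset.insert_subset ha hT.1, iff_of_true (Finset.mem_insert_self _ _) ?_⟩
      rw [Finset.mem_insert]; push Not; exact ⟨hab.symm, h⟩
  · rw [Finset.mem_coe, Finset.mem_filter, Finset.mem_powerset] at hS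
    simp only [Finset.mem_erase, ne_eq, hab.symm, not_false_eq_true, true_and]
    split_ifs with h
    · have : a ∉ S := fun ha' => (hS.2.1 ha') h
      rw [Finset.erase_eq_of_notMem this]
    · exact Finset.insert_erase (hS.2.2 h)
  · rw [Finset.mem_coe, Finset.mem_powerset, Finset.subset_erase] at hT
    dsimp only
    split_ifs with h
    · exact Finset.erase_eq_of_notMem hT.2
    · exact Finset.erase_insert hT.2

/-- ★★ THE REVERSAL-PAIR COUNT: `#revData = (2j−7)‼ · 2^{2j−3}` (`m = 2j`, `j ≥ 3`). [cite: MadrasSlade1993, Definition 1.2.4; lane theorem] -/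
theorem card_revData {j : ℕ} (hm : m = 2 * j) (hj : 3 ≤ j) (hi : i + 4 ≤ m) (hq : SepAdj m i q) :
    (revData m i q hq.2).card = (2 * j - 7).doubleFactorial * 2 ^ (2 * j - 3) := by
  classical
  obtain ⟨hqB, hq1B, hqF, hq1F⟩ := sep_facts hq
  have hq' := hq; unfold SepAdj at hq'
  set Q0 : Fin m := ⟨q, by omega⟩ with hQ0
  set Q1 : Fin m := ⟨q + 1, by omega⟩ with hQ1
  have hQQ : Q0 ≠ Q1 := by simp [hQ0, hQ1, Fin.ext_iff]
  have hsplit : revData m i q hq.2 = ((pairPartitions (outside m i)).filter fun π => ({Q0, Q1} : Finset (Fin m)) ∈ π) ×ˢ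
      ((freePos m i).powerset.filter fun S => Q0 ∈ S ↔ Q1 ∉ S) := by
    unfold revData topData
    ext d
    simp only [Finset.mem_filter, Finset.mem_product]
    tauto
  have hO : (outside m i \ {Q0, Q1}).card = 2 * (j - 3) := by
    rw [Finset.card_sdiff_of_subset (by
      intro x hx; simp only [Finset.mem_insert, Finset.mem_singleton] at hx
      rcases hx with rfl | rfl
      exacts [mem_outside.2 hqB, mem_outside.2 hq1B]), card_outside hi, Finset.card_pair hQQ]
    omega
  rw [hsplit, Finset.card_product, card_pairPartitions_filter_pair (mem_outside.2 hqB) (mem_outside.2 hq1B) hQQ,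
    card_powerset_filter_opposite hqF hQQ, card_freePos hi, card_pairPartitions_of_card_eq_two_mul hO]
  have e1 : 2 * (j - 3) - 1 = 2 * j - 7 := by omega
  have e2 : m - 2 - 1 = 2 * j - 3 := by omega
  rw [e1, e2]

/-- ★★★ THE SPLIT CLASS COUNT: `#shapeClass j (2j) (splitVec (2j) i q) = (2j−5)‼·2^{2j−2} − (2j−7)‼·2^{2j−3}` for every block position `i + 4 ≤ 2j` and separated
`q` (`j ≥ 3`). [cite: MadrasSlade1993, Definition 1.2.4; lane theorem] -/
theorem card_shapeClass_splitVec {j i q : ℕ} (hj : 3 ≤ j) (hi : i + 4 ≤ 2 * j) (hq : SepAdj (2 * j) i q) :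
    (shapeClass j (2 * j) (splitVec (2 * j) i q)).card + (2 * j - 7).doubleFactorial * 2 ^ (2 * j - 3) = (2 * j - 5).doubleFactorial * 2 ^ (2 * j - 2) := by
  classical
  have h := Finset.card_filter_add_card_filter_not (s := shapeClass j (2 * j) (topVec (2 * j) i))
    (fun κ => κ ⟨q + 1, by unfold SepAdj at hq; omega⟩ = ((κ ⟨q, by unfold SepAdj at hq; omega⟩).1, !(κ ⟨q, by unfold SepAdj at hq; omega⟩).2))
  rw [card_revPairs_eq_card_revData rfl hi hq, card_revData rfl hj hi hq, card_shapeClass_top hi] at h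
  rw [shapeClass_splitVec_eq_filter hi hq]
  omega

end RevPairs

end WordTypes

end Literature.Probability.RandomPlanarGeometry.SAW.Zd
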